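import Summits.Ventures.QEC.Census.CertMitmK
import Summits.Ventures.QEC.Census.TwoBGA.A1p_n168_k20_bf5b89fa.Cert
import HarnessLib

/-!
# `A1p_n168_k20_bf5b89fa` — KERNEL meet-in-the-middle replay, side Z, file 3/3 (emitted by qec-type-07, 07.MITMK)

Generic lane `Census/CertMitmK.lean` over the certificate data `TwoBGA/A1p_n168_k20_bf5b89fa/Cert.lean`: side Z = Z-type operators,
syndromes by `cert.HX` (84 rows), `wmax = d − 1 = 5 = wa + wb = 3 + 2`. The table of all patterns of
weight `≤ 2` (1 part(s), kernel-built by `tabFindQ`, keys mixed at 84 bits) is self-checked (T1ᴿ,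
`tableTestR`) and every pattern of weight `≤ 3` is probed against it (T3ᴿ, `probeTestR`, packed level-1 chunks
`chunk1RF` of `Census/CertCheckBZFast.lean` = `CertChunks.chunk1R`); allow-list = (A1p_n168_k20_bf5b89fa.cert.sideZ.found.map Prod.fst). 2 theorem(s) here,
each ONE `decide +kernel` (tier KERNEL: axioms ⊆ {propext, Classical.choice, Quot.sound}), run one at a time
(`Elab.async false`); ≈ 184 s of kernel time predicted by the emitter's replica (HOME/census/type-07/mitmk_lib.py),
which also pre-computed every verdict below as `true`. The side is ASSEMBLED (first-order terms only) in `Distance.lean`.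
Do not edit; re-emit (HOME/census/type-07/emit_mitmk.py).
-/

set_option Elab.async false

namespace Summit.Ventures.QEC.Census.A1p_n168_k20_bf5b89fa

/-- (T3ᴿ) Probes with first qubit in `[61, 98)` (`147038` patterns of weight `1 … 3`) against table part 0 of side Z: no hit, or hit up to `0` / an allow-listed stabilizer word. -/
theorem pZ0_61 :
    chunk1RF (probeTestR (tabFindQ (posList 168 A1p_n168_k20_bf5b89fa.cert.HX) 84 2 0 168) (A1p_n168_k20_bf5b89fa.cert.sideZ.found.map Prod.fst)) (posList 168 A1p_n168_k20_bf5b89fa.cert.HX) 2 61 37 = true := by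
  decide +kernel

/-- (T3ᴿ) Probes with first qubit in `[98, 168)` (`57225` patterns of weight `1 … 3`) against table part 0 of side Z: no hit, or hit up to `0` / an allow-listed stabilizer word. -/
theorem pZ0_98 :
    chunk1RF (probeTestR (tabFindQ (posList 168 A1p_n168_k20_bf5b89fa.cert.HX) 84 2 0 168) (A1p_n168_k20_bf5b89fa.cert.sideZ.found.map Prod.fst)) (posList 168 A1p_n168_k20_bf5b89fa.cert.HX) 2 98 70 = true := by
  decide +kernel

end Summit.Ventures.QEC.Census.A1p_n168_k20_bf5b89fa
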